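import Summits.AtomisticToContinuum.HydrodynamicLimit.Theses.OneFlightGossipEngine

/-!
# The dock of route `OneFlightGossipEngine` — negative lemma: a refutation of the dock is a refutation of the conjunct

Filed for the crux protocol on the rev-7 dock `ClampedCurrentsDock` (stmt-AtomisticToContinuum-14680,
`KineticCurrentsWindowLDUniform → EquilibriumClampedCollisionalWindowLD → CollisionActivityTails →
EnergyCurrentTails → DiluteSelfConsistency → HydrodynamicLimit`; disprover
refuter-cdisprove-stmt-AtomisticToContinuum-14680-0, `Cruxes/ClampedCurrentsDock/Disproof.lean`). That item was
RETIRED by the route repair of 2026-08-16 (rev 21: `EquilibriumClampedCollisionalWindowLD`, stmt-13733, was refuted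
and left this route; the dock was restated as `ClampedTransferDock`, stmt-16657 → 16665 → 17615), so the Theses
module no longer declares `ClampedCurrentsDock` / `EquilibriumClampedCollisionalWindowLD` and the rev-7 lemmas
stopped elaborating (fullbuild breakage, dependency drift). The observation itself is about the SHAPE of a dock and
carries over verbatim to the live one, `ClampedTransferDock := KineticCurrentsLDAlongFamilies →
CollisionActivityTails → EnergyCurrentTails → HydrodynamicLimit` (rev 29): because the consequent is the
sub-problem Statement, `¬ ClampedTransferDock` is EQUIVALENT to "all three antecedents hold and `HydrodynamicLimit`
fails" (`clampedTransferDock_not_iff`, `clampedTransferDock_not_elim`). Consequences for the crux protocol: no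
counterexample search can kill the dock without settling the conjunct negatively; the disprover's work on a dock
is vacuity of the antecedents and joint sufficiency of the line's stubs.

The bare corollary `¬ ClampedTransferDock → ¬ HydrodynamicLimit` is already a landed declaration,
`ClampedTransferDockNegative.not_hydrodynamicLimit_of_not_clampedTransferDock`
(`Theorems/ClampedTransferDock/Negative/DockShape.lean`, filed for rev 25), and is not restated here; it is the last
component of `clampedTransferDock_not_elim`. The two rev-7 declaration names are kept (append-only) as deprecated
aliases of the re-targeted lemmas.
-/

namespace Summit.AtomisticToContinuum.HydrodynamicLimit.Theorems

open Summit.AtomisticToContinuum.HydrodynamicLimit.Theses.OneFlightGossipEngine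

/-- **`¬ ClampedTransferDock` unfolds to "the three inputs hold and the conjunct fails".** (Classical logic:
`¬ (A → B → C → H) ↔ A ∧ B ∧ C ∧ ¬ H`, with `H` the sub-problem Statement.) [folklore] -/
theorem clampedTransferDock_not_iff :
    ¬ ClampedTransferDock ↔
      (KineticCurrentsLDAlongFamilies ∧ CollisionActivityTails ∧ EnergyCurrentTails ∧
        ¬ _root_.HydrodynamicLimit) := by
  unfold ClampedTransferDock
  simp only [Classical.not_imp]

/-- **What a refutation of the dock would certify**: the three crux antecedents `KineticCurrentsLDAlongFamilies`,
`CollisionActivityTails`, `EnergyCurrentTails` all hold AND the sub-problem Statement `HydrodynamicLimit` fails —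
in particular (last component) any refutation of the dock refutes the conjunct. [folklore] -/
theorem clampedTransferDock_not_elim (h : ¬ ClampedTransferDock) :
    KineticCurrentsLDAlongFamilies ∧ CollisionActivityTails ∧ EnergyCurrentTails ∧ ¬ _root_.HydrodynamicLimit :=
  clampedTransferDock_not_iff.1 h

/-- Deprecated rev-7 name: stated for the retired dock `ClampedCurrentsDock` (stmt-AtomisticToContinuum-14680,
five antecedents), which the Theses module no longer declares since the 2026-08-16 route repair; the live form
is `clampedTransferDock_not_iff`. [folklore] -/
@[deprecated clampedTransferDock_not_iff (since := "2026-08-17")]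
alias clampedCurrentsDock_not_iff := clampedTransferDock_not_iff

/-- Deprecated rev-7 name (was `¬ ClampedCurrentsDock → ¬ HydrodynamicLimit` for the retired dock
stmt-AtomisticToContinuum-14680); the live form is `clampedTransferDock_not_elim`, whose last component is that
implication for `ClampedTransferDock` (also landed alone as
`ClampedTransferDockNegative.not_hydrodynamicLimit_of_not_clampedTransferDock`). [folklore] -/
@[deprecated clampedTransferDock_not_elim (since := "2026-08-17")]
alias clampedCurrentsDock_not_imp_not_hydrodynamicLimit := clampedTransferDock_not_elim

end Summit.AtomisticToContinuum.HydrodynamicLimit.Theorems
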